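import Summits.BirchSwinnertonDyer.BirchSwinnertonDyer.Theorems.PrintCf2SplitBadTwoRestrictedSelmerCokernelBound
import HarnessLib

/-!
# Crux `PrintCf2.SplitBadTwoRankOneOfFacts` (stmt-BirchSwinnertonDyer-20368), road α v10.3 — S3c residual (R-SURJ), file 1/3:
# THE EXACT COKERNEL OF CONTROL — `[𝔖^Γ : res 𝔖_𝔮(K, M)] · #ker(res) = [A : 𝔖_𝔮(K, M)] · #(𝔖_𝔮(K, M) ∩ ker res)` and `[A : 𝔖_𝔮(K, M)] ∣ ∏_w #LK_w`

Cell `bsd-print-cf2`, width seat `bsd-line-cf2-p1-w5` g3 (prover-bsd-line-cf2-p1-w5-g3-0); lane «(R-SURJ)» of LEAD g12's residual board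
(`LEAD-VERDICT-cf2p1-g12.md` §6; cut 4 = `restrictedControl_two_of_residuals_split_places`, p666063). `--supports stmt-BirchSwinnertonDyer-20368`
(helper, Theses-free). HONEST FRAMING: nothing here closes the crux or a registered stub; BSD is not proved by any of this; no summit statement
is proved by this seat. No definition, no named fact, no `sorry`.

WHAT. In the four-index identity of S3c (`hasCharValuationAt_control_identity_endEigenPrimaryTorsion`, -w7 p652120 / p653109) the COKERNEL term
is `[𝔖^Γ : res 𝔖_{v̄}(K, W*)]`, `𝔖 = 𝔖_{v̄}(K*_∞, W*)`. LEAD g11's p658316 `relIndex_le_prod_natCard_localKer` BOUNDS it by the product of the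
local kernels `LK_w = ker (H¹(D_w, M) → H¹(D_w ∩ Gal(K̄/K_∞), M))` via the subgroup `A := res⁻¹(𝔖^Γ) ≤ H¹(K, M)` of LIFTS (`res : A ↠ 𝔖^Γ`,
Greenberg Lemma 3.2) and `A/𝔖_𝔮(K, M) ↪ ⊕ LK_w`; LEAD g12's cut 4 DISPLAYS the hypothesis (R-SURJ) «`[𝔖^Γ : res 𝔖] = (∏_{w∈T} #LK_w) · #LK_{v̄}`»
(memo `S3C-DEFECT-VANISHES-g12.md`: «δ = 1», the local-class map `A → ⊕ LK_w` is onto). THIS FILE (generic: any number field `K`, `ℤ_p`-line `κ`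
with generator `γ`, discrete `p`-primary `M` with continuous orbit maps, place `𝔮`) computes the cokernel EXACTLY — the surjection `res : A ↠ 𝔖^Γ`
has kernel `ker res` (`= H¹(Γ, M(K_∞))` by inflation–restriction, file 2/3), which an inequality absorbs but an EQUALITY cannot:
* §1 (abelian groups) `index_map_mul_natCard_ker_eq_index_mul_natCard_inf`: for `g : A ↠ E` and `B ≤ A`,
  `[E : g(B)] · #ker g = [A : B] · #(B ∩ ker g)` (`AddSubgroup.index_map`, `relIndex_sup_left`, `card_mul_index`);
  `index_ker_dvd_natCard`: `[A : ker φ] ∣ #P` for `φ : A → P`, `P` finite (Lagrange).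
* §2 **`relIndex_mul_natCard_ker_eq_index_mul_natCard_inf`: `[𝔖^Γ : res 𝔖_𝔮(K, M)] · #ker(res) = [A : 𝔖_𝔮(K, M)] · #(𝔖_𝔮(K, M) ∩ ker res)`**
  with `A = res⁻¹(𝔖^Γ)` written out as `((𝔖^Γ).map 𝔖.subtype).comap res`;
  `index_lifts_dvd_prod_natCard_localKer`: `[A : 𝔖_𝔮(K, M)] ∣ (∏_{w∈T} #LK_w) · #LK_𝔮` whenever the local kernels vanish at the finite `w ∤ p`
  off `T` and at infinity and are finite on `T ∪ {𝔮}` (p658316's local-class map, kernel `𝔖_𝔮(K, M)`; `[A : 𝔖_𝔮(K, M)] = ∏` IS «δ = 1»);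
  `relIndex_mul_natCard_ker_dvd_prod_natCard_localKer_mul`: `[𝔖^Γ : res 𝔖] · #ker(res) ∣ (∏_{w∈T} #LK_w) · #LK_𝔮 · #(𝔖_𝔮(K, M) ∩ ker res)`.
So `[𝔖^Γ : res 𝔖]` can reach the full product ONLY IF `#ker(res) = #(𝔖_𝔮(K, M) ∩ ker res)`, i.e. only if the whole inflation kernel lies in
`𝔖_𝔮(K, M)`. Files 2/3–3/3: `#ker(res) = #(M(K_∞)/(γ−1))` generically, `= 2` on every road-α frame while `#(𝔖 ∩ ker res) = 1` under (H7) — so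
(R-SURJ) as displayed fails on every such frame; the honest «δ = 1» is (R-SURJ′) `[𝔖^Γ : res 𝔖] · 2 = (∏_{w∈T} #LK_w) · #LK_{v̄}`.
presearch: Greenberg LNM 1716 §3 Lemmas 3.1–3.3 (held, PDF pp. 86–88: the snake for `s_n, h_n, g_n`, `ker(h_n) ≅ H¹(Γ_n, B)`); Agboola 2007 §3
Prop. 3.2 (arXiv:math/0602192 p0008: "the kernel and cokernel of the restriction map … are finite and bounded" — a BOUND, no exact value in
print) — held; no new Literature fact filed. beyond-print theorem: no.

References: [GreenbergLNM1716] §3 Lemmas 3.1–3.3 (pp. 86–88); [Agboola2007] §3 Prop. 3.2 (arXiv p0008:L128–135, L197).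
-/

noncomputable section

open scoped Classical

set_option linter.dupNamespace false
set_option autoImplicit false

open NumberField IsDedekindDomain Field
open Literature.NumberTheory.EllipticCurves Literature.NumberTheory.EllipticCurves.GreenbergSelmer
open Literature.NumberTheory.EllipticCurves.Agboola2007
open Literature.NumberTheory.EllipticCurves.IwasawaDual
open Literature.NumberTheory.EllipticCurves.ResKernel
open Literature.NumberTheory.GaloisRepresentations

universe u

namespace Summit.BirchSwinnertonDyer.BirchSwinnertonDyer.Theorems.PrintCf2.RestrictedSelmerPair

/-! ## §1. Index algebra: the index of an image under a surjection, with the kernel accounted for -/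

section IndexAlgebra

variable {A E : Type*} [AddCommGroup A] [AddCommGroup E]

/-- **`[E : g(B)] · #ker g = [A : B] · #(B ∩ ker g)`** for a surjection `g : A ↠ E` of abelian groups and a subgroup `B ≤ A`
(all four quantities as `Nat.card`/`index`, `0` when infinite): `[E : g(B)] = [A : B + ker g]` (`AddSubgroup.index_map`),
`[A : B] = [B + ker g : B] · [A : B + ker g]`, and `[B + ker g : B] = [ker g : B ∩ ker g]` (second isomorphism theorem,
`AddSubgroup.relIndex_sup_left`), `#(B ∩ ker g) · [ker g : B ∩ ker g] = #ker g`. [folklore] -/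
theorem index_map_mul_natCard_ker_eq_index_mul_natCard_inf (g : A →+ E) (hg : Function.Surjective g) (B : AddSubgroup A) :
    (B.map g).index * Nat.card g.ker = B.index * Nat.card ↥(B ⊓ g.ker) := by
  have h1 : (B.map g).index = (B ⊔ g.ker).index := by
    rw [AddSubgroup.index_map, AddMonoidHom.range_eq_top_of_surjective g hg, AddSubgroup.index_top, mul_one]
  have h2 : B.relIndex (B ⊔ g.ker) * (B ⊔ g.ker).index = B.index := AddSubgroup.relIndex_mul_index le_sup_left
  have h3 : B.relIndex (B ⊔ g.ker) = B.relIndex g.ker := AddSubgroup.relIndex_sup_left _ _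
  have h4 : Nat.card ↥(B.addSubgroupOf g.ker) * B.relIndex g.ker = Nat.card g.ker := AddSubgroup.card_mul_index _
  have h5 : Nat.card ↥(B.addSubgroupOf g.ker) = Nat.card ↥(B ⊓ g.ker) := by
    rw [← AddSubgroup.inf_addSubgroupOf_right]
    exact Nat.card_congr (AddSubgroup.addSubgroupOfEquivOfLe (inf_le_right : B ⊓ g.ker ≤ g.ker)).toEquiv
  calc (B.map g).index * Nat.card g.ker
      = (B ⊔ g.ker).index * (Nat.card ↥(B.addSubgroupOf g.ker) * B.relIndex g.ker) := by rw [h1, h4]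
    _ = (B.relIndex (B ⊔ g.ker) * (B ⊔ g.ker).index) * Nat.card ↥(B.addSubgroupOf g.ker) := by rw [h3]; ring
    _ = B.index * Nat.card ↥(B ⊓ g.ker) := by rw [h2, h5]

/-- **`[A : ker φ] ∣ #P`** for a homomorphism `φ : A → P` to a finite abelian group: `A / ker φ ≅ range φ ≤ P` (Lagrange). [folklore] -/
theorem index_ker_dvd_natCard {P : Type*} [AddCommGroup P] [Finite P] (φ : A →+ P) :
    φ.ker.index ∣ Nat.card P := by
  rw [AddSubgroup.index_eq_card, Nat.card_congr (QuotientAddGroup.quotientKerEquivRange φ).toEquiv]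
  exact AddSubgroup.card_addSubgroup_dvd_card φ.range

end IndexAlgebra

/-! ## §2. The control setting: `[𝔖^Γ : res 𝔖_𝔮(K, M)] · #ker(res) = [A : 𝔖_𝔮(K, M)] · #(𝔖_𝔮(K, M) ∩ ker res)`, `[A : 𝔖_𝔮(K, M)] ∣ ∏_w #LK_w` -/

section Coker

variable {K : Type u} [Field K] [NumberField K] {p : ℕ} [Fact p.Prime] (κ : ZpExtension K p)
  (M : Type u) [AddCommGroup M] [DistribMulAction (absoluteGaloisGroup K) M]
  [TopologicalSpace M] [DiscreteTopology M] (𝔮 : HeightOneSpectrum (𝓞 K))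

/-- **THE EXACT COKERNEL OF CONTROL.** `κ` a `ℤ_p`-line of a number field `K` with topological generator `γ`, `M` a discrete
`p`-primary `Γ_K`-module with continuous orbit maps, `𝔮` a place; `res : H¹(K, M) → H¹(K_∞, M)`, `𝔖 := 𝔖_𝔮(K_∞, M)`,
`𝔖^Γ := ker(conj_γ − 1 | 𝔖)`, and **`A := res⁻¹(𝔖^Γ) ≤ H¹(K, M)`** (the subgroup of LIFTS; every class of `𝔖^Γ` lifts, Greenberg
Lemma 3.2, so `res : A ↠ 𝔖^Γ` with kernel `ker res = H¹(Γ, M(K_∞))`, Lemma 3.1). Then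
**`[𝔖^Γ : res 𝔖_𝔮(K, M)] · #ker(res) = [A : 𝔖_𝔮(K, M)] · #(𝔖_𝔮(K, M) ∩ ker res)`**
(as natural numbers, `Nat.card`/`index` conventions; §1 applied to `res|_A`). The factor `#ker(res) = #H¹(Γ, M(K_∞))` is the
inflation kernel; `𝔖_𝔮(K, M) ∩ ker res` is the kernel of control. [cite: GreenbergLNM1716, §3 Lemmas 3.1–3.2 (p. 86)]
[cite: Agboola2007, §3 Prop. 3.2 (arXiv p0008:L128–135, L197)] -/
theorem relIndex_mul_natCard_ker_eq_index_mul_natCard_inf {γ : absoluteGaloisGroup K} (hγ : κ.IsTopGenerator γ)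
    (hcont : ∀ m : M, Continuous fun g : absoluteGaloisGroup K ↦ g • m) (hprim : ∀ m : M, ∃ k : ℕ, p ^ k • m = 0) :
    (((restrictedSelmerBase M p 𝔮).map (resOfLe M (le_top : κ.kerSubgroup ≤ ⊤))).addSubgroupOf
        (restrictedSelmerZp κ M 𝔮)).relIndex (endInvariants (conjRestricted κ M 𝔮 γ - 1)) *
      Nat.card (resOfLe M (le_top : κ.kerSubgroup ≤ ⊤)).ker =
    ((restrictedSelmerBase M p 𝔮).addSubgroupOf
        (((endInvariants (conjRestricted κ M 𝔮 γ - 1)).map (restrictedSelmerZp κ M 𝔮).subtype).comap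
          (resOfLe M (le_top : κ.kerSubgroup ≤ ⊤)))).index *
      Nat.card ↥(restrictedSelmerBase M p 𝔮 ⊓ (resOfLe M (le_top : κ.kerSubgroup ≤ ⊤)).ker) := by
  -- notation (as in `relIndex_le_prod_natCard_localKer`)
  set H := κ.kerSubgroup with hHdef
  set f : subgroupH1 (⊤ : Subgroup (absoluteGaloisGroup K)) M →+ subgroupH1 H M := resOfLe M (le_top : H ≤ ⊤) with hfdef
  set S := restrictedSelmerZp κ M 𝔮 with hSdef
  set E : AddSubgroup S := endInvariants (conjRestricted κ M 𝔮 γ - 1) with hEdef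
  set SK := restrictedSelmerBase M p 𝔮 with hSKdef
  set A : AddSubgroup (subgroupH1 (⊤ : Subgroup (absoluteGaloisGroup K)) M) := (E.map S.subtype).comap f with hAdef
  have hAS : ∀ x ∈ A, f x ∈ S := by
    rintro x ⟨e, -, hex⟩
    rw [← hex]; exact e.2
  have hAE : ∀ (x) (hx : x ∈ A), (⟨f x, hAS x hx⟩ : S) ∈ E := by
    rintro x hx
    obtain ⟨e, he, hex⟩ := hx
    have : (⟨f x, hAS x ⟨e, he, hex⟩⟩ : S) = e := Subtype.ext hex.symm
    rw [this]; exact he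
  have hmemA : ∀ (x) (hS : f x ∈ S), (⟨f x, hS⟩ : S) ∈ E → x ∈ A := fun x hS hE ↦ ⟨⟨f x, hS⟩, hE, rfl⟩
  -- `SK ≤ A` and `ker f ≤ A`
  have hSKA : SK ≤ A := by
    intro c hc
    refine hmemA c (resOfLe_mem_restrictedSelmer M p 𝔮 le_top hc) ?_
    rw [hEdef, mem_endInvariants_conjRestricted_iff]
    exact conjH1_resOfLe_of_mem M (le_top : H ≤ ⊤) (Subgroup.mem_top γ) c
  have hKA : f.ker ≤ A := by
    intro c hc
    have h0 : f c = 0 := (AddMonoidHom.mem_ker).mp hc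
    refine hmemA c (by rw [h0]; exact S.zero_mem) ?_
    have : (⟨f c, by rw [h0]; exact S.zero_mem⟩ : S) = 0 := Subtype.ext h0
    rw [this]; exact E.zero_mem
  -- the map `g : A → E`, onto
  let g : A →+ E :=
    { toFun := fun x ↦ ⟨⟨f x, hAS x x.2⟩, hAE x x.2⟩
      map_zero' := Subtype.ext (Subtype.ext (by simp only [ZeroMemClass.coe_zero, map_zero]))
      map_add' := fun a b ↦ Subtype.ext (Subtype.ext (by simp only [AddSubgroup.coe_add, map_add])) }
  have hg : Function.Surjective g := by
    intro y
    obtain ⟨x, hx⟩ := exists_resOfLe_top_eq_of_mem_endInvariants κ M 𝔮 hγ hcont hprim (y := (y : S)) y.2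
    have hxS : f x ∈ S := by rw [hfdef, hx]; exact (y : S).2
    have hxA : x ∈ A := hmemA x hxS (by
      have : (⟨f x, hxS⟩ : S) = (y : S) := Subtype.ext hx
      rw [this]; exact y.2)
    exact ⟨⟨x, hxA⟩, Subtype.ext (Subtype.ext hx)⟩
  -- `ker g = (ker f) ∩ A`
  have hkerg : g.ker = f.ker.addSubgroupOf A := by
    ext x
    rw [AddMonoidHom.mem_ker, AddSubgroup.mem_addSubgroupOf, AddMonoidHom.mem_ker]
    constructor
    · intro h
      exact congrArg (fun e : E ↦ ((e : S) : subgroupH1 H M)) h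
    · intro h
      exact Subtype.ext (Subtype.ext h)
  -- `B := SK` inside `A`; its image under `g` is the image of `SK` inside `E`
  set B : AddSubgroup A := SK.addSubgroupOf A with hBdef
  have hBg : B.map g = ((SK.map f).addSubgroupOf S).addSubgroupOf E := by
    apply le_antisymm
    · rintro _ ⟨x, hxB, rfl⟩
      rw [AddSubgroup.mem_addSubgroupOf, AddSubgroup.mem_addSubgroupOf]
      exact ⟨(x : subgroupH1 ⊤ M), AddSubgroup.mem_addSubgroupOf.mp hxB, rfl⟩
    · intro e he
      rw [AddSubgroup.mem_addSubgroupOf, AddSubgroup.mem_addSubgroupOf] at he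
      obtain ⟨c, hc, hce⟩ := he
      refine ⟨⟨c, hSKA hc⟩, AddSubgroup.mem_addSubgroupOf.mpr hc, ?_⟩
      exact Subtype.ext (Subtype.ext hce)
  -- §1
  have key := index_map_mul_natCard_ker_eq_index_mul_natCard_inf g hg B
  have hrel : (((SK.map f).addSubgroupOf S).relIndex E) = (((SK.map f).addSubgroupOf S).addSubgroupOf E).index := rfl
  have hcardK : Nat.card g.ker = Nat.card f.ker := by
    rw [hkerg]
    exact Nat.card_congr (AddSubgroup.addSubgroupOfEquivOfLe hKA).toEquiv
  have hinf : B ⊓ g.ker = (SK ⊓ f.ker).addSubgroupOf A := by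
    rw [hkerg, hBdef]
    ext x
    simp only [AddSubgroup.mem_inf, AddSubgroup.mem_addSubgroupOf]
  have hcardI : Nat.card ↥(B ⊓ g.ker) = Nat.card ↥(SK ⊓ f.ker) := by
    rw [hinf]
    exact Nat.card_congr (AddSubgroup.addSubgroupOfEquivOfLe (le_trans inf_le_right hKA)).toEquiv
  rw [hrel, ← hBg, ← hcardK, key, hcardI]

/-- **`[A : 𝔖_𝔮(K, M)]` DIVIDES THE PRODUCT OF THE LOCAL KERNELS.** With `A = res⁻¹(𝔖^Γ)` as above and a finite set `T` of finite
places prime to `p` such that the local kernels `LK_w := ker (H¹(D_w, M) → H¹(D_w ∩ Gal(K̄/K_∞), M))` vanish at every finite `w ∤ p`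
outside `T` and at every infinite place and are finite at `w ∈ T` and at `𝔮`: the local-class map `A → (∏_{w∈T} LK_w) × LK_𝔮` has
kernel exactly `𝔖_𝔮(K, M)` (`mem_restrictedSelmerBase_iff_of_localKer_eq_bot`), so **`[A : 𝔖_𝔮(K, M)] ∣ (∏_{w∈T} #LK_w) · #LK_𝔮`**
(Lagrange in the finite product); `[A : 𝔖_𝔮(K, M)] = (∏_{w∈T} #LK_w) · #LK_𝔮` is exactly the SURJECTIVITY of the local-class map.
[cite: GreenbergLNM1716, §3 Lemmas 3.2–3.3 (pp. 86–88)] [cite: Agboola2007, §3 Prop. 3.2 (arXiv p0008:L128–135, L197)] -/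
theorem index_lifts_dvd_prod_natCard_localKer (γ : absoluteGaloisGroup K)
    (T : Finset (HeightOneSpectrum (𝓞 K))) (hTp : ∀ w ∈ T, ((p : ℕ) : 𝓞 K) ∉ w.asIdeal)
    (hT0 : ∀ w : HeightOneSpectrum (𝓞 K), ((p : ℕ) : 𝓞 K) ∉ w.asIdeal → w ∉ T →
      (resOfLe M (inf_le_inf_right (decomp w) (le_top : κ.kerSubgroup ≤ ⊤))).ker = ⊥)
    (hinf : ∀ w : InfinitePlace K, (resOfLe M (inf_le_inf_right (decompInf w) (le_top : κ.kerSubgroup ≤ ⊤))).ker = ⊥)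
    (hfinT : ∀ w ∈ T, Finite (resOfLe M (inf_le_inf_right (decomp w) (le_top : κ.kerSubgroup ≤ ⊤))).ker)
    (hfinq : Finite (resOfLe M (inf_le_inf_right (decomp 𝔮) (le_top : κ.kerSubgroup ≤ ⊤))).ker) :
    ((restrictedSelmerBase M p 𝔮).addSubgroupOf
        (((endInvariants (conjRestricted κ M 𝔮 γ - 1)).map (restrictedSelmerZp κ M 𝔮).subtype).comap
          (resOfLe M (le_top : κ.kerSubgroup ≤ ⊤)))).index ∣
      (∏ w ∈ T, Nat.card (resOfLe M (inf_le_inf_right (decomp w) (le_top : κ.kerSubgroup ≤ ⊤))).ker) *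
        Nat.card (resOfLe M (inf_le_inf_right (decomp 𝔮) (le_top : κ.kerSubgroup ≤ ⊤))).ker := by
  set H := κ.kerSubgroup with hHdef
  set f : subgroupH1 (⊤ : Subgroup (absoluteGaloisGroup K)) M →+ subgroupH1 H M := resOfLe M (le_top : H ≤ ⊤) with hfdef
  set S := restrictedSelmerZp κ M 𝔮 with hSdef
  set E : AddSubgroup S := endInvariants (conjRestricted κ M 𝔮 γ - 1) with hEdef
  set SK := restrictedSelmerBase M p 𝔮 with hSKdef
  set A : AddSubgroup (subgroupH1 (⊤ : Subgroup (absoluteGaloisGroup K)) M) := (E.map S.subtype).comap f with hAdef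
  have hAS : ∀ x ∈ A, f x ∈ S := by
    rintro x ⟨e, -, hex⟩
    rw [← hex]; exact e.2
  set B : AddSubgroup A := SK.addSubgroupOf A with hBdef
  -- the local-class map `φ : A → (∏_{w ∈ T} LK_w) × LK_𝔮`, kernel `B`
  let LK : (w : HeightOneSpectrum (𝓞 K)) →
      AddSubgroup (subgroupH1 ((⊤ : Subgroup (absoluteGaloisGroup K)) ⊓ decomp w) M) := fun w ↦
    (resOfLe M (inf_le_inf_right (decomp w) (le_top : H ≤ ⊤))).ker
  have hloc : ∀ (x : A) (w : HeightOneSpectrum (𝓞 K)), ((p : ℕ) : 𝓞 K) ∉ w.asIdeal ∨ w = 𝔮 →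
      resOfLe M (inf_le_left : ⊤ ⊓ decomp w ≤ ⊤) (x : subgroupH1 ⊤ M) ∈ LK w := by
    intro x w hw
    obtain ⟨hfin', -, hq⟩ := resOfLe_decomp_mem_localKer_of_mem κ M 𝔮 (hAS x x.2)
    rcases hw with hw | rfl
    · exact hfin' w hw
    · exact hq
  let G := subgroupH1 (⊤ : Subgroup (absoluteGaloisGroup K)) M
  let locw : (w : HeightOneSpectrum (𝓞 K)) →
      (G →+ subgroupH1 ((⊤ : Subgroup (absoluteGaloisGroup K)) ⊓ decomp w) M) := fun w ↦
    resOfLe M (inf_le_left : ⊤ ⊓ decomp w ≤ ⊤)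
  let φ : A →+ (Π w : ↥T, LK (w : HeightOneSpectrum (𝓞 K))) × LK 𝔮 :=
    { toFun := fun x ↦ (fun w ↦ ⟨locw w (x : G), hloc x w (Or.inl (hTp w w.2))⟩, ⟨locw 𝔮 (x : G), hloc x 𝔮 (Or.inr rfl)⟩)
      map_zero' := by
        refine Prod.ext (funext fun w ↦ Subtype.ext ?_) (Subtype.ext ?_)
        · show locw w ((0 : A) : G) = ((0 : LK (w : HeightOneSpectrum (𝓞 K))) :
            subgroupH1 ((⊤ : Subgroup (absoluteGaloisGroup K)) ⊓ decomp (w : HeightOneSpectrum (𝓞 K))) M)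
          rw [ZeroMemClass.coe_zero, map_zero, ZeroMemClass.coe_zero]
        · show locw 𝔮 ((0 : A) : G) = ((0 : LK 𝔮) : subgroupH1 ((⊤ : Subgroup (absoluteGaloisGroup K)) ⊓ decomp 𝔮) M)
          rw [ZeroMemClass.coe_zero, map_zero, ZeroMemClass.coe_zero]
      map_add' := fun a b ↦ by
        refine Prod.ext (funext fun w ↦ Subtype.ext ?_) (Subtype.ext ?_)
        · show locw w ((a : G) + (b : G)) = locw w (a : G) + locw w (b : G)
          exact map_add _ _ _
        · show locw 𝔮 ((a : G) + (b : G)) = locw 𝔮 (a : G) + locw 𝔮 (b : G)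
          exact map_add _ _ _ }
  have hφ1 : ∀ (x : A) (w : ↥T), (((φ x).1 w : LK (w : HeightOneSpectrum (𝓞 K))) :
      subgroupH1 ((⊤ : Subgroup (absoluteGaloisGroup K)) ⊓ decomp (w : HeightOneSpectrum (𝓞 K))) M) =
      resOfLe M (inf_le_left : ⊤ ⊓ decomp (w : HeightOneSpectrum (𝓞 K)) ≤ ⊤) (x : G) := fun _ _ ↦ rfl
  have hφ2 : ∀ x : A, (((φ x).2 : LK 𝔮) : subgroupH1 ((⊤ : Subgroup (absoluteGaloisGroup K)) ⊓ decomp 𝔮) M) =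
      resOfLe M (inf_le_left : ⊤ ⊓ decomp 𝔮 ≤ ⊤) (x : G) := fun _ ↦ rfl
  have hkerφ : φ.ker = B := by
    ext x
    rw [AddMonoidHom.mem_ker, hBdef, AddSubgroup.mem_addSubgroupOf,
      mem_restrictedSelmerBase_iff_of_localKer_eq_bot κ M 𝔮 T hT0 hinf (hAS x x.2)]
    constructor
    · intro h0
      refine ⟨fun w hwT _ ↦ ?_, ?_⟩
      · rw [← hφ1 x ⟨w, hwT⟩, h0]; rfl
      · rw [← hφ2 x, h0]; rfl
    · rintro ⟨h1, h2⟩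
      refine Prod.ext (funext fun w ↦ Subtype.ext ?_) (Subtype.ext ?_)
      · rw [hφ1]; exact h1 w w.2 (hTp w w.2)
      · rw [hφ2]; exact h2
  -- counting
  haveI hfinP : Finite ((Π w : ↥T, LK (w : HeightOneSpectrum (𝓞 K))) × LK 𝔮) := by
    haveI : ∀ w : ↥T, Finite (LK (w : HeightOneSpectrum (𝓞 K))) := fun w ↦ hfinT w w.2
    haveI := hfinq
    infer_instance
  have hcardP : Nat.card ((Π w : ↥T, LK (w : HeightOneSpectrum (𝓞 K))) × LK 𝔮) =
      (∏ w ∈ T, Nat.card (LK w)) * Nat.card (LK 𝔮) := by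
    rw [Nat.card_prod, Nat.card_pi, ← Finset.prod_coe_sort T (fun w ↦ Nat.card (LK w))]
  rw [← hcardP, ← hkerφ]
  exact index_ker_dvd_natCard φ

/-- **`[𝔖^Γ : res 𝔖_𝔮(K, M)] · #ker(res) ∣ (∏_{w∈T} #LK_w) · #LK_𝔮 · #(𝔖_𝔮(K, M) ∩ ker res)`** — the cokernel bound of p658316 WITH THE
INFLATION KERNEL ACCOUNTED FOR (the two theorems above). In particular, when the control kernel `𝔖_𝔮(K, M) ∩ ker res` is TRIVIAL,
`[𝔖^Γ : res 𝔖_𝔮(K, M)] · #H¹(Γ, M(K_∞))` divides the product of the local kernels: the index can reach the full product ONLY IF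
`M(K_∞)` has trivial `Γ`-coinvariants. [cite: GreenbergLNM1716, §3 Lemmas 3.1–3.3 (pp. 86–88)] [cite: Agboola2007, §3 Prop. 3.2] -/
theorem relIndex_mul_natCard_ker_dvd_prod_natCard_localKer_mul {γ : absoluteGaloisGroup K} (hγ : κ.IsTopGenerator γ)
    (hcont : ∀ m : M, Continuous fun g : absoluteGaloisGroup K ↦ g • m) (hprim : ∀ m : M, ∃ k : ℕ, p ^ k • m = 0)
    (T : Finset (HeightOneSpectrum (𝓞 K))) (hTp : ∀ w ∈ T, ((p : ℕ) : 𝓞 K) ∉ w.asIdeal)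
    (hT0 : ∀ w : HeightOneSpectrum (𝓞 K), ((p : ℕ) : 𝓞 K) ∉ w.asIdeal → w ∉ T →
      (resOfLe M (inf_le_inf_right (decomp w) (le_top : κ.kerSubgroup ≤ ⊤))).ker = ⊥)
    (hinf : ∀ w : InfinitePlace K, (resOfLe M (inf_le_inf_right (decompInf w) (le_top : κ.kerSubgroup ≤ ⊤))).ker = ⊥)
    (hfinT : ∀ w ∈ T, Finite (resOfLe M (inf_le_inf_right (decomp w) (le_top : κ.kerSubgroup ≤ ⊤))).ker)
    (hfinq : Finite (resOfLe M (inf_le_inf_right (decomp 𝔮) (le_top : κ.kerSubgroup ≤ ⊤))).ker) :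
    (((restrictedSelmerBase M p 𝔮).map (resOfLe M (le_top : κ.kerSubgroup ≤ ⊤))).addSubgroupOf
        (restrictedSelmerZp κ M 𝔮)).relIndex (endInvariants (conjRestricted κ M 𝔮 γ - 1)) *
      Nat.card (resOfLe M (le_top : κ.kerSubgroup ≤ ⊤)).ker ∣
      (∏ w ∈ T, Nat.card (resOfLe M (inf_le_inf_right (decomp w) (le_top : κ.kerSubgroup ≤ ⊤))).ker) *
        Nat.card (resOfLe M (inf_le_inf_right (decomp 𝔮) (le_top : κ.kerSubgroup ≤ ⊤))).ker *
        Nat.card ↥(restrictedSelmerBase M p 𝔮 ⊓ (resOfLe M (le_top : κ.kerSubgroup ≤ ⊤)).ker) := by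
  rw [relIndex_mul_natCard_ker_eq_index_mul_natCard_inf κ M 𝔮 hγ hcont hprim]
  exact mul_dvd_mul_right (index_lifts_dvd_prod_natCard_localKer κ M 𝔮 γ T hTp hT0 hinf hfinT hfinq) _

end Coker
end Summit.BirchSwinnertonDyer.BirchSwinnertonDyer.Theorems.PrintCf2.RestrictedSelmerPair

end
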